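import Summits.ResolutionOfSingularities.ResolutionOfSingularities.Theorems.MarkedTransferCampaignW24ReducedBridgePSlice
import Summits.ResolutionOfSingularities.ResolutionOfSingularities.Theorems.MarkedTransferCampaignW24ReducedBridgePEscape
import HarnessLib

/-!
# The LEVEL-`q` bridge at an ARBITRARY PRIME `p`, part 6: DIE-OR-ESCAPE at each depth, and the OURS premise on a one-variable twin carrier
# `Φ_{q,r₀} G₀` is EQUIVALENT to in-box exhaustion of the reduced run at infinitely many `p`-power depths (HIRONAKA-L · cell `res-hironaka` ·
# slot W2.4 «bottom-member re-run»; capstone of res-D-pv-020's `…ReducedBridgeP{Hasse,Datum,Step,Run,Escape}.lean`)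

**HONEST FRAMING.** OURS throughout: kernel theorems connecting OURS objects of the cell (res-L1-k24's `CampaignW24.ReducedRun` with its digit
lemma `exists_order_stepI`, res-type-059's `CampaignW24.StaysInBox`, res-D-pv-020's `CampaignW24.ReducedBridge(P)`). Nothing below is a
statement of H. Hironaka's manuscript [Hironaka2017] (lit key `paper:url-3343fd9e678b`), nothing asserts that any statement of it holds, nothing is
a claim about resolution of singularities in characteristic `p`; the manuscript stays «under review» (D-0012/D-0089). AI work, weaker than expert
review. Written by res-D-pv-020 (W2.4 lineage).

## What is proved (`K` of characteristic `p`, `p` prime)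
* `reduced_run_dichotomy`: for `2 ≤ ord G₀` and every depth `p^L`, the canonical reduced run has a first index `i₁` at which it is either DEAD
  (`= 0`, «exhausted in box») or has ESCAPED (`≠ 0` of order `≥ p^L`), all earlier states being non-zero with `2 ≤ ord < p^L`
  (res-L1-k24's `exists_order_stepI`: the bottom digit strictly rises).
* **`carrierStaysInBox_phiQ_iff`** (`K` with the premise binders; `0 < e`; `r₀ < q = p^e`, `p ∤ r₀`; `G₀ ≠ 0`, `2 ≤ ord G₀`):
  `Rescue.CarrierStaysInBox p e (Φ_{q,r₀} G₀) ↔ ∀ a₀, ∃ a ≥ a₀, ∃ i₁, (∀ i < i₁, canonRun p^a G₀ i ≠ 0 ∧ 2 ≤ ord < p^a) ∧ canonRun p^a G₀ i₁ = 0`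
  — the OURS premise on the twin carrier IS «exhausted in box at infinitely many `p`-power depths» (← `…PSlice`, → `…PEscape` + dichotomy).
  At `p = 2` the right side holds for every finitely supported `G₀` (res-L1-type-o6); at odd `p` it is the open reduced question, now in exact form.
Nothing for `n ≥ 2`; bottom digit `1` (the Case-(III) first step) is covered by `…PSlice`/`…QRun`, not restated here.
Hypotheses: each theorem's own binders; no FACT-LIST fact, no DEFECT binder. Standard axioms only.
-/

noncomputable section

set_option linter.dupNamespace false -- mandated namespace of this single-conjunct summit

namespace Summit.ResolutionOfSingularities.ResolutionOfSingularities.Theorems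

namespace CampaignW24

namespace ReducedBridgeP

open Literature.AlgebraicGeometry.Hironaka2017.S08UnitMonomial (StandardExpression)
open Literature.AlgebraicGeometry.Hironaka2017.S09LLUED
open Literature.AlgebraicGeometry.Hironaka2017.S09LLUED.TopFrontier
open CampaignW21 (xs hasseD)
open ReducedBridge

variable {K : Type} [Field K] {p : ℕ} [hp : Fact p.Prime] [CharP K p]

/-! ## §1 Die or escape at each depth -/

/-- **DIE-OR-ESCAPE.** For `2 ≤ ord G₀` and a depth `p^L` there is an index `i₁` such that the canonical reduced states `i < i₁` are non-zero
with `2 ≤ ord < p^L` and the state `i₁` is either `0` (exhausted in box) or non-zero of order `≥ p^L` (escaped): the bottom digit strictly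
rises along the run (res-L1-k24's `exists_order_stepI`), so one of the two happens within `p^L` steps. [folklore] -/
theorem reduced_run_dichotomy (L : ℕ) {G₀ : PowerSeries K} (h2 : (2 : ℕ∞) ≤ PowerSeries.order G₀) :
    ∃ i₁ : ℕ, (∀ i < i₁, ReducedRun.canonRun (p ^ L) G₀ i ≠ 0 ∧ (2 : ℕ∞) ≤ PowerSeries.order (ReducedRun.canonRun (p ^ L) G₀ i) ∧
        PowerSeries.order (ReducedRun.canonRun (p ^ L) G₀ i) < ((p ^ L : ℕ) : ℕ∞)) ∧
      (ReducedRun.canonRun (p ^ L) G₀ i₁ = 0 ∨ (ReducedRun.canonRun (p ^ L) G₀ i₁ ≠ 0 ∧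
        ((p ^ L : ℕ) : ℕ∞) ≤ PowerSeries.order (ReducedRun.canonRun (p ^ L) G₀ i₁))) := by
  by_contra hno
  push Not at hno
  -- every state is alive in the box, with order at least `i + 2`
  have hall : ∀ i, (∀ j < i, ReducedRun.canonRun (p ^ L) G₀ j ≠ 0 ∧
      (2 : ℕ∞) ≤ PowerSeries.order (ReducedRun.canonRun (p ^ L) G₀ j) ∧
      PowerSeries.order (ReducedRun.canonRun (p ^ L) G₀ j) < ((p ^ L : ℕ) : ℕ∞)) ∧
      ((i + 2 : ℕ) : ℕ∞) ≤ PowerSeries.order (ReducedRun.canonRun (p ^ L) G₀ i) := by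
    intro i
    induction i with
    | zero => exact ⟨fun j hj => absurd hj (Nat.not_lt_zero j), by simpa [ReducedRun.canonRun] using h2⟩
    | succ i ih =>
      obtain ⟨hprev, hordi⟩ := ih
      obtain ⟨hne, hesc⟩ := hno i hprev
      have h2i : (2 : ℕ∞) ≤ PowerSeries.order (ReducedRun.canonRun (p ^ L) G₀ i) :=
        le_trans (by exact_mod_cast (by omega : 2 ≤ i + 2)) hordi
      have hlt : PowerSeries.order (ReducedRun.canonRun (p ^ L) G₀ i) < ((p ^ L : ℕ) : ℕ∞) := hesc hne
      have hgood : ∀ j < i + 1, ReducedRun.canonRun (p ^ L) G₀ j ≠ 0 ∧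
          (2 : ℕ∞) ≤ PowerSeries.order (ReducedRun.canonRun (p ^ L) G₀ j) ∧
          PowerSeries.order (ReducedRun.canonRun (p ^ L) G₀ j) < ((p ^ L : ℕ) : ℕ∞) := by
        intro j hj
        rcases Nat.lt_succ_iff_lt_or_eq.mp hj with hj' | rfl
        · exact hprev j hj'
        · exact ⟨hne, h2i, hlt⟩
      refine ⟨hgood, ?_⟩
      -- the next state: alive (else `i + 1` would be a death index), of strictly larger order
      obtain ⟨hne', -⟩ := hno (i + 1) hgood
      set Gi := ReducedRun.canonRun (p ^ L) G₀ i with hGi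
      set k := (PowerSeries.order Gi).toNat with hk
      have hfin : PowerSeries.order Gi = (k : ℕ∞) := (ENat.coe_toNat fun h => hne (PowerSeries.order_eq_top.mp h)).symm
      have hkP : k < p ^ L := by rw [hfin] at hlt; exact_mod_cast hlt
      have hki : i + 2 ≤ k := by rw [hfin] at hordi; exact_mod_cast hordi
      have hstep : ReducedRun.canonRun (p ^ L) G₀ (i + 1) = ReducedRun.stepI (ReducedRun.unitPart (p ^ L) k Gi)⁻¹ k Gi := by
        show ReducedRun.canonStepI (p ^ L) Gi = _
        rw [ReducedRun.canonStepI, ← hk]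
      rw [hstep] at hne' ⊢
      obtain ⟨k', hk', hkk', -⟩ := ReducedRun.exists_order_stepI p hkP (ReducedRun.inv_unitPart_mul hfin) hfin hne'
      rw [hk']
      exact_mod_cast (by omega : i + 1 + 2 ≤ k')
  -- at `i = p^L` the order is both `< p^L` and `≥ p^L + 2`
  obtain ⟨hbox, hbig⟩ := hall (p ^ L)
  obtain ⟨hne, hesc⟩ := hno (p ^ L) hbox
  have hlt := hesc hne
  have := lt_of_le_of_lt hbig hlt
  have h' : p ^ L + 2 < p ^ L := by exact_mod_cast this
  omega

/-! ## §2 The OURS premise on a twin carrier ⟺ in-box exhaustion at infinitely many `p`-power depths -/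

/-- **THE TWIN-CARRIER EQUIVALENCE.** `K` a field of characteristic `p` with the premise binders, `0 < e`, `r₀ < q = p^e` with `p ∤ r₀`,
`G₀ ≠ 0` with `2 ≤ ord G₀` (bottom digit `≥ 2`). Then `Rescue.CarrierStaysInBox p e (Φ_{q,r₀} G₀)` holds IF AND ONLY IF the canonical reduced run
of `G₀` is EXHAUSTED IN BOX at infinitely many `p`-power depths. (←) every reference datum of depth `ℓ₀` is served by a depth `e + a ≥ ℓ₀` of
exhaustion (`…PSlice`); (→) otherwise, by die-or-escape, the run ESCAPES at every large `p`-power depth and `…PEscape` refutes the premise.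
OURS objects; nothing about the manuscript. [folklore] -/
theorem carrierStaysInBox_phiQ_iff [ExpChar K p] [PerfectRing K p] {e : ℕ} (he : 0 < e) {r₀ : ℕ} (hr₀ : r₀ < p ^ e) (hr₀p : r₀ % p ≠ 0)
    {G₀ : PowerSeries K} (hG₀ : G₀ ≠ 0) (h2 : (2 : ℕ∞) ≤ PowerSeries.order G₀) :
    Rescue.CarrierStaysInBox p e (phiQ (p ^ e) (ppow_ne_zero p e) r₀ G₀) ↔
      ∀ a₀ : ℕ, ∃ a : ℕ, a₀ ≤ a ∧ ∃ i₁ : ℕ,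
        (∀ i < i₁, ReducedRun.canonRun (p ^ a) G₀ i ≠ 0 ∧ (2 : ℕ∞) ≤ PowerSeries.order (ReducedRun.canonRun (p ^ a) G₀ i) ∧
          PowerSeries.order (ReducedRun.canonRun (p ^ a) G₀ i) < ((p ^ a : ℕ) : ℕ∞)) ∧
        ReducedRun.canonRun (p ^ a) G₀ i₁ = 0 := by
  have hF₀ : phiQ (p ^ e) (ppow_ne_zero p e) r₀ G₀ = phiQ (p ^ e) (ppow_ne_zero p e) r₀ G₀ + 0 := (add_zero _).symm
  have hRin : ResIn (p ^ e) (fun _ => False) (0 : MvPowerSeries (Fin 1) K) := resIn_zero _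
  have hG₀0 : PowerSeries.constantCoeff G₀ = 0 := by
    rw [← PowerSeries.coeff_zero_eq_constantCoeff_apply]
    exact PowerSeries.coeff_of_lt_order 0 (lt_of_lt_of_le (by exact_mod_cast Nat.zero_lt_two) h2)
  constructor
  · intro h
    by_contra hex
    push Not at hex
    obtain ⟨a₀, ha₀⟩ := hex
    refine not_carrierStaysInBox_of_escapesP he hr₀ hr₀p hG₀ hG₀0 (a₀ := a₀) (fun a ha => ?_) h
    obtain ⟨i₁, hpre, hend⟩ := reduced_run_dichotomy (p := p) a h2
    rcases hend with hzero | ⟨hne, hP⟩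
    · exact absurd hzero (ha₀ a ha i₁ hpre)
    · exact ⟨i₁, fun i hi => ⟨(hpre i hi).1, (hpre i hi).2.1⟩, hne, hP⟩
  · intro hex ℓ₀ X₀ _ hle h0 _ _
    obtain ⟨a, ha, i₁, hpre, hzero⟩ := hex ℓ₀
    refine ⟨e + a, by omega, ?_⟩
    have hae : e + a - e = a := by omega
    refine staysInBox_of_level_of_reduced_exhaustionP he (by omega) hr₀ (good := fun _ => False) (fun _ h => h.elim) hG₀ X₀ hF₀
      hRin hle (fun _ h => h.elim) (i₁ := i₁) ?_ ?_
    · rw [hae]; exact hpre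
    · rw [hae]; exact hzero

end ReducedBridgeP

end CampaignW24

end Summit.ResolutionOfSingularities.ResolutionOfSingularities.Theorems

end
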